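import Summits.RiemannHypothesis.RiemannHypothesis.Theorems.JensenLogBandArcModelCompareWindow
import Summits.RiemannHypothesis.RiemannHypothesis.Theorems.JensenLogBandEllPerturbation
import HarnessLib

/-!
# Main term versus translated-saddle model, V: [CMP] instantiated at a near point of the top shell

RH ladder column JENSEN, rung J-P(P3) «log band», BAND crux `XiDerivBandRealAllRates`
(stmt-RiemannHypothesis-19913) of route «JensenLogBand», line «band-one-window» (top-shell reshape,
BAND lead rh-jensen-prover g8; custodian theory g12's HDISC-RECIPE §1 (d), the `εc`-input of the ONE
remaining disc estimate `HDISC`). RH-FREE bookkeeping. WHAT THIS IS NOT: nothing here bears on zeros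
of `ζ` off the line or the truth of RH.

**`norm_arcMainTerm_sub_arcShiftModel_le_near`.** In the context of `HDISC c` at `(k, x, T)` — rate
`7 ≤ c < 8`, `a₀ = 2/c − ¼`, `|x| ≤ a₀`, `T ≥ 200`, `ℓ_T ≥ 200`, `c(k−1)/2 − 4 ≤ ℓ_T ≤ ck/2`,
`4/c < h ≤ 4/c + 1/log k`, `h ≤ 7T/20`, `k ≥ 100`, together with the ONE extra threshold `40 ≤ a₀·ℓ_T`
(a `k`-threshold, since `ℓ_T ≥ 3.5k − 7.5`) — for the saddle `u₀` at the centre `v₀ = x + iT` and ANY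
disc point `v = x′ + iT′`, `‖v − v₀‖ ≤ 3/ℓ_T`, with its own saddle `u*`:
`‖Main(v, u*) − M̃_{v₀,u₀}(v)‖ ≤ (1/100)·‖M̃_{v₀,u₀}(v)‖`.
All hypotheses of part IV (`norm_arcMainTerm_sub_arcShiftModel_le_of_window_of_large`) are discharged
here: the pins at `v` by theory g12's `near_point_regime` (slack `s = 2a₀`, `4/c = ½ + 2a₀`), the two
windows with `δ = a₀/2` from `arcSaddle_sharp_polar` at `v₀` and at `v` (margins `≥ a₀ − 8.2/ℓ`,
`≥ a₀ − 14.5/ℓ`), and `10⁴k² ≤ (a₀/2)·T` from `T ≥ e^{ℓ_T} ≥ e^{3k} ≥ k⁶/64`.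
`norm_arcMainTerm_sub_arcShiftModel_le_near'` is the same keyed on a complex point `v` (`x′ = Re v`,
`T′ = Im v`); `norm_arcMainTerm_sub_arcShiftModel_le_near_eventually` folds the two scalar thresholds
into `∃ k₁(c)` (`near_thresholds_eventually`), leaving EXACTLY the `HDISC` binders. (prover-rh-jensen-eng-2-g7-0, 2026-08-27.)
-/

noncomputable section

-- single-problem summit: `Summit.RiemannHypothesis.RiemannHypothesis.…` is the tree convention
set_option linter.dupNamespace false

open Complex Real Set Metric

namespace Summit.RiemannHypothesis.RiemannHypothesis.Theorems.JensenPolynomials.LogBandArc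

open Literature.NumberTheory.LFunctions

section near

/-- `e^{3k} ≥ k⁶/64` (`e^{k/2} ≥ 1 + k/2 ≥ k/2`). [folklore] -/
theorem pow_six_div_le_exp_three_mul {k : ℝ} (hk : 0 ≤ k) : k ^ 6 / 64 ≤ Real.exp (3 * k) := by
  have h1 : k / 2 ≤ Real.exp (k / 2) := by linarith [Real.add_one_le_exp (k / 2)]
  have h2 : (k / 2) ^ 6 ≤ Real.exp (k / 2) ^ 6 := pow_le_pow_left₀ (by positivity) h1 6
  have h3 : Real.exp (k / 2) ^ 6 = Real.exp (3 * k) := by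
    rw [← Real.exp_nat_mul]; congr 1; push_cast; ring
  rw [h3] at h2
  have e : (k / 2) ^ 6 = k ^ 6 / 64 := by ring
  linarith

/-- `T ≥ e^{ℓ_T} + 1` and `1/T ≤ 1/ℓ_T` for `ℓ_T ≥ 1` (`T = 2π e^{ℓ_T}`). [folklore] -/
theorem exp_ell_le {T : ℝ} (hT : 0 < T) (hℓ : 1 ≤ ell T) :
    Real.exp (ell T) + 1 ≤ T ∧ 1 / T ≤ 1 / ell T := by
  have hTexp : 2 * π * Real.exp (ell T) = T := by
    rw [ell, Real.exp_log (by positivity)]; field_simp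
  have hpi : 3 < π := Real.pi_gt_three
  have he1 : 1 ≤ Real.exp (ell T) := Real.one_le_exp (by linarith)
  have hT1 : Real.exp (ell T) + 1 ≤ T := by
    calc Real.exp (ell T) + 1 ≤ 2 * π * Real.exp (ell T) := by nlinarith
      _ = T := hTexp
  have hℓe : ell T ≤ Real.exp (ell T) := by linarith [Real.add_one_le_exp (ell T)]
  exact ⟨hT1, one_div_le_one_div_of_le (by linarith) (by linarith)⟩

variable {c : ℝ} {k : ℕ} {x T x' T' : ℝ} {u₀ u : ℂ}

set_option maxHeartbeats 800000 in -- a long list of explicit real bookkeeping steps, each small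
/-- **[CMP] at a near point of the top shell** (hypotheses = the `HDISC` context of theory g12's
`shellNear_of_discModels` at `(k, x, T)`, plus `k ≥ 100` and the threshold `40 ≤ a₀ ℓ_T`): for the
centre saddle `u₀` and a disc point `v = x′ + iT′`, `‖v − v₀‖ ≤ 3/ℓ_T`, with saddle `u*`,
`‖Main(v,u*) − M̃_{v₀,u₀}(v)‖ ≤ (1/100)‖M̃_{v₀,u₀}(v)‖`. RH-FREE. [folklore] -/
theorem norm_arcMainTerm_sub_arcShiftModel_le_near (hc7 : 7 ≤ c) (hc8 : c < 8) (hk : 100 ≤ k)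
    (hx : |x| ≤ 2 / c - 1 / 4) (hT : 200 ≤ T) (hℓ : 200 ≤ ell T)
    (hℓlo : c * ((k : ℝ) - 1) / 2 - 4 ≤ ell T) (hℓhi : ell T ≤ c * (k : ℝ) / 2)
    (hh : 4 / c < bandRadius k T) (hh' : bandRadius k T ≤ 4 / c + 1 / Real.log k)
    (hhT : bandRadius k T ≤ 7 / 20 * T) (hℓa : 40 ≤ (2 / c - 1 / 4) * ell T)
    (hu₀ : ‖u₀ - ((x : ℂ) + (T : ℂ) * I + bandRadius k T)‖ ≤ 3 / 5 * bandRadius k T)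
    (hS₀ : arcSaddleFn k ((x : ℂ) + (T : ℂ) * I) u₀ = 0)
    (hv : ‖((x' : ℂ) + (T' : ℂ) * I) - ((x : ℂ) + (T : ℂ) * I)‖ ≤ 3 / ell T)
    (hu : ‖u - ((x' : ℂ) + (T' : ℂ) * I + bandRadius k T')‖ ≤ 3 / 5 * bandRadius k T')
    (hS : arcSaddleFn k ((x' : ℂ) + (T' : ℂ) * I) u = 0) :
    ‖arcMainTerm k ((x' : ℂ) + (T' : ℂ) * I) u -
        arcShiftModel k ((x : ℂ) + (T : ℂ) * I) u₀ ((x' : ℂ) + (T' : ℂ) * I)‖ ≤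
      1 / 100 * ‖arcShiftModel k ((x : ℂ) + (T : ℂ) * I) u₀ ((x' : ℂ) + (T' : ℂ) * I)‖ := by
  -- the near half-width
  have hc0 : 0 < c := by linarith only [hc7]
  set a₀ : ℝ := 2 / c - 1 / 4 with ha₀def
  clear_value a₀
  have ha₀ : 0 < a₀ := by
    have : 1 / 4 < 2 / c := by rw [div_lt_div_iff₀ (by norm_num) hc0]; linarith only [hc8]
    linarith only [this, ha₀def]
  have ha₀' : a₀ ≤ 1 / 28 := by
    have : 2 / c ≤ 2 / 7 := div_le_div_of_nonneg_left (by norm_num) (by norm_num) hc7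
    linarith only [this, ha₀def]
  have h4c : 4 / c = 1 / 2 + 2 * a₀ := by rw [ha₀def]; ring
  have hx' := abs_le.1 hx
  have hT0 : 0 < T := by linarith only [hT]
  have hℓ0 : 0 < ell T := by linarith only [hℓ]
  have hk' : (100 : ℝ) ≤ k := by exact_mod_cast hk
  have hk0 : (0 : ℝ) ≤ k := by linarith only [hk']
  -- `h ≤ 1` (`1/log k ≤ 3/7` for `k ≥ 100`)
  have hlogk : 7 / 3 ≤ Real.log k := by
    rw [Real.le_log_iff_exp_le (by linarith only [hk'])]
    have h3 : Real.exp (7 / 3) ≤ Real.exp 3 := Real.exp_le_exp.2 (by norm_num)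
    have he : Real.exp 3 = Real.exp 1 ^ 3 := by rw [← Real.exp_nat_mul]; norm_num
    have h1 := Real.exp_one_lt_d9
    have h0 := Real.exp_pos (1 : ℝ)
    have h2 : Real.exp 1 ^ 3 ≤ (2.7182818286 : ℝ) ^ 3 := pow_le_pow_left₀ h0.le h1.le 3
    norm_num at h2
    linarith only [h3, he, h2, hk']
  have hH1 : bandRadius k T ≤ 1 := by
    have h1 : 1 / Real.log k ≤ 3 / 7 := by
      rw [div_le_div_iff₀ (by linarith only [hlogk]) (by norm_num)]; linarith only [hlogk]
    have h2 : 4 / c ≤ 4 / 7 := div_le_div_of_nonneg_left (by norm_num) (by norm_num) hc7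
    linarith only [hh', h1, h2]
  have hh12 : 1 / 2 ≤ bandRadius k T := by linarith only [hh, h4c, ha₀]
  have hH20 : bandRadius k T ≤ 20 := by linarith only [hH1]
  have hx12 : |x| ≤ 1 / 2 := hx.trans (by linarith only [ha₀'])
  -- `1/T ≤ 1/ℓ ≤ a₀/40 ≤ 2a₀`, `T ≥ e^ℓ + 1`
  obtain ⟨hTexp, hTℓ⟩ := exp_ell_le hT0 (by linarith only [hℓ])
  have hℓa' : 1 / ell T ≤ a₀ / 40 := by
    rw [div_le_div_iff₀ hℓ0 (by norm_num)]; linarith only [hℓa]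
  have hℓ200 : 1 / ell T ≤ 1 / 200 := one_div_le_one_div_of_le (by norm_num) hℓ
  have hTa : 1 / T ≤ 2 * a₀ := by linarith only [hTℓ, hℓa', ha₀]
  -- pins at the disc point
  obtain ⟨hxv, hTv, hℓv, hℓv100, hhv, hhv12, hhv20, hhvT⟩ :=
    near_point_regime k (s := 2 * a₀) (v := (x' : ℂ) + (T' : ℂ) * I) (hx.trans (by linarith only [ha₀']))
      hT hℓ hTa (by linarith only [hh, h4c]) hH1 hv
  have hvre : ((x' : ℂ) + (T' : ℂ) * I).re = x' := by simp
  have hvim : ((x' : ℂ) + (T' : ℂ) * I).im = T' := by simp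
  rw [hvre] at hxv
  rw [hvim] at hTv hℓv hℓv100 hhv hhv12 hhv20 hhvT
  have hT'100 : 100 ≤ T' := hTv
  have hℓ'20 : 20 ≤ ell T' := by linarith only [hℓv100]
  have hhv' := abs_le.1 hhv
  have hℓv' := abs_le.1 hℓv
  -- coordinates of the displacement
  have hdx : |x' - x| ≤ 3 / ell T := by
    have := (Complex.abs_re_le_norm (((x' : ℂ) + (T' : ℂ) * I) - ((x : ℂ) + (T : ℂ) * I))).trans hv
    simpa using this
  have hdT : |T' - T| ≤ 3 / ell T := by
    have := (Complex.abs_im_le_norm (((x' : ℂ) + (T' : ℂ) * I) - ((x : ℂ) + (T : ℂ) * I))).trans hv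
    simpa using this
  have hdx' := abs_le.1 hdx
  have hdT' := abs_le.1 hdT
  have h3ℓ : 3 / ell T ≤ 3 * (a₀ / 40) := by
    rw [div_eq_mul_one_div]; exact mul_le_mul_of_nonneg_left hℓa' (by norm_num)
  -- the window at the translate: `Re(½ + (u₀ − v₀ + v)) = Re(½+u₀) + (x′ − x) ≥ 1 + a₀ − 8.2/ℓ`
  obtain ⟨hre₀, -, -, -⟩ :=
    arcSaddle_sharp_polar hx12 (by linarith only [hT]) (by linarith only [hℓ]) hk hh12 hhT hH20 hu₀ hS₀
  have hε₀ : (2 + 16 / 5 * bandRadius k T) / ell T ≤ 26 / 5 * (a₀ / 40) := by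
    have h1 : (2 + 16 / 5 * bandRadius k T) / ell T ≤ (26 / 5) / ell T :=
      div_le_div_of_nonneg_right (by linarith only [hH1]) hℓ0.le
    rw [div_eq_mul_one_div (26 / 5 : ℝ)] at h1
    exact h1.trans (mul_le_mul_of_nonneg_left hℓa' (by norm_num))
  have hσt : 1 + a₀ / 2 ≤ (1 / 2 + (u₀ - ((x : ℂ) + (T : ℂ) * I) + ((x' : ℂ) + (T' : ℂ) * I))).re := by
    have e : (1 / 2 + (u₀ - ((x : ℂ) + (T : ℂ) * I) + ((x' : ℂ) + (T' : ℂ) * I))).re =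
        1 / 2 + ((u₀ - ((x : ℂ) + (T : ℂ) * I)).re + x') := by simp
    rw [e]
    linarith only [hre₀, hε₀, hdx'.1, hx'.1, hh, h4c, h3ℓ, ha₀]
  -- the window at the disc point's own saddle: `Re(½+u*) ≥ ½ + x′ + h′ − ε′ ≥ 1 + a₀ − 14.5/ℓ`
  obtain ⟨hre₁, -, -, -⟩ := arcSaddle_sharp_polar hxv hT'100 hℓ'20 hk hhv12 hhvT hhv20 hu hS
  have hε₁ : (2 + 16 / 5 * bandRadius k T') / ell T' ≤ 11 * (a₀ / 40) := by
    -- `h′ ≤ h + 1/T ≤ 1 + 1/200`, `ℓ′ ≥ ℓ − 10⁻⁴ ≥ ℓ/2`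
    have hnum : 2 + 16 / 5 * bandRadius k T' ≤ 11 / 2 := by linarith only [hhv'.1, hH1, hTℓ, hℓ200]
    have hden : ell T / 2 ≤ ell T' := by linarith only [hℓv'.1, hℓ]
    calc (2 + 16 / 5 * bandRadius k T') / ell T' ≤ (11 / 2) / (ell T / 2) :=
          div_le_div₀ (by norm_num) hnum (by linarith only [hℓ]) hden
      _ = 11 * (1 / ell T) := by field_simp
      _ ≤ 11 * (a₀ / 40) := mul_le_mul_of_nonneg_left hℓa' (by norm_num)
  have hσu : 1 + a₀ / 2 ≤ (1 / 2 + u).re := by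
    have e : (1 / 2 + u).re = 1 / 2 + (x' + (u - ((x' : ℂ) + (T' : ℂ) * I)).re) := by simp
    rw [e]
    linarith only [hdx'.1, hx'.1, hre₁, hε₁, hhv'.2, hh, h4c, hTℓ, hℓa', h3ℓ, ha₀]
  -- the largeness hypothesis `10⁴ k² ≤ (a₀/2)·T`
  have hlarge : (10 : ℝ) ^ 4 * (k : ℝ) ^ 2 ≤ a₀ / 2 * T := by
    have hck : 7 * ((k : ℝ) - 1) ≤ c * ((k : ℝ) - 1) :=
      mul_le_mul_of_nonneg_right hc7 (by linarith only [hk'])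
    have hℓ3k : 3 * (k : ℝ) ≤ ell T := by linarith only [hck, hℓlo, hk']
    have hexp : (k : ℝ) ^ 6 / 64 ≤ Real.exp (ell T) :=
      (pow_six_div_le_exp_three_mul hk0).trans (Real.exp_le_exp.2 hℓ3k)
    have hTbig : (k : ℝ) ^ 6 / 64 ≤ T := by linarith only [hexp, hTexp]
    have hck' : c * (k : ℝ) ≤ 8 * (k : ℝ) := mul_le_mul_of_nonneg_right hc8.le hk0
    have hℓ4k : ell T ≤ 4 * k := by linarith only [hck', hℓhi]
    have ha₀ℓ : a₀ * ell T ≤ a₀ * (4 * k) := mul_le_mul_of_nonneg_left hℓ4k ha₀.le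
    have ha₀k : 10 ≤ a₀ * k := by linarith only [hℓa, ha₀ℓ]
    have hk3 : (100 : ℝ) ^ 3 ≤ (k : ℝ) ^ 3 := pow_le_pow_left₀ (by norm_num) hk' 3
    have hk2 : 0 ≤ (k : ℝ) ^ 2 := sq_nonneg _
    have step : (10 : ℝ) ^ 4 * (k : ℝ) ^ 2 ≤ a₀ / 2 * ((k : ℝ) ^ 6 / 64) := by
      have e1 : a₀ / 2 * ((k : ℝ) ^ 6 / 64) = (a₀ * k) * (k : ℝ) ^ 2 * (k : ℝ) ^ 3 / 128 := by ring
      rw [e1]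
      have h1 : 10 * (k : ℝ) ^ 2 * (100 : ℝ) ^ 3 ≤ (a₀ * k) * (k : ℝ) ^ 2 * (k : ℝ) ^ 3 :=
        mul_le_mul (mul_le_mul_of_nonneg_right ha₀k hk2) hk3 (by positivity) (by positivity)
      linarith only [h1, hk2]
    exact step.trans (mul_le_mul_of_nonneg_left hTbig (by linarith only [ha₀]))
  -- apply part IV with `R = 3/ℓ_T`, `δ = a₀/2`
  have hR : 3 / ell T ≤ 1 / 20 := by
    rw [div_le_div_iff₀ hℓ0 (by norm_num)]; linarith only [hℓ]
  exact norm_arcMainTerm_sub_arcShiftModel_le_of_window_of_large hx12 (by linarith only [hT])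
    (by linarith only [hℓ]) hk hh12 hhT hH20 hu₀ hS₀ hxv hT'100 hℓ'20 hhv12 hhvT hhv20 hu hS hR hv
    (by linarith only [ha₀]) hσt hσu hlarge

/-- **[CMP] at a near point, keyed on a complex disc point `v`** (`x′ = Re v`, `T′ = Im v`; the
saddle `u*` as delivered by `exists_arcSaddleFn_eq_zero` at `(Re v, Im v)`). RH-FREE. [folklore] -/
theorem norm_arcMainTerm_sub_arcShiftModel_le_near' (hc7 : 7 ≤ c) (hc8 : c < 8) (hk : 100 ≤ k)
    (hx : |x| ≤ 2 / c - 1 / 4) (hT : 200 ≤ T) (hℓ : 200 ≤ ell T)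
    (hℓlo : c * ((k : ℝ) - 1) / 2 - 4 ≤ ell T) (hℓhi : ell T ≤ c * (k : ℝ) / 2)
    (hh : 4 / c < bandRadius k T) (hh' : bandRadius k T ≤ 4 / c + 1 / Real.log k)
    (hhT : bandRadius k T ≤ 7 / 20 * T) (hℓa : 40 ≤ (2 / c - 1 / 4) * ell T)
    (hu₀ : ‖u₀ - ((x : ℂ) + (T : ℂ) * I + bandRadius k T)‖ ≤ 3 / 5 * bandRadius k T)
    (hS₀ : arcSaddleFn k ((x : ℂ) + (T : ℂ) * I) u₀ = 0) {v : ℂ}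
    (hv : ‖v - ((x : ℂ) + (T : ℂ) * I)‖ ≤ 3 / ell T)
    (hu : ‖u - (((v.re : ℝ) : ℂ) + ((v.im : ℝ) : ℂ) * I + bandRadius k v.im)‖ ≤
      3 / 5 * bandRadius k v.im)
    (hS : arcSaddleFn k (((v.re : ℝ) : ℂ) + ((v.im : ℝ) : ℂ) * I) u = 0) :
    ‖arcMainTerm k v u - arcShiftModel k ((x : ℂ) + (T : ℂ) * I) u₀ v‖ ≤
      1 / 100 * ‖arcShiftModel k ((x : ℂ) + (T : ℂ) * I) u₀ v‖ := by
  have e : (((v.re : ℝ) : ℂ) + ((v.im : ℝ) : ℂ) * I) = v := Complex.re_add_im v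
  have hv' : ‖(((v.re : ℝ) : ℂ) + ((v.im : ℝ) : ℂ) * I) - ((x : ℂ) + (T : ℂ) * I)‖ ≤ 3 / ell T := by
    rw [e]; exact hv
  have h := norm_arcMainTerm_sub_arcShiftModel_le_near hc7 hc8 hk hx hT hℓ hℓlo hℓhi hh hh' hhT hℓa hu₀
    hS₀ hv' hu hS
  rw [e] at h
  exact h


/-- The two scalar thresholds of `norm_arcMainTerm_sub_arcShiftModel_le_near` (`k ≥ 100`,
`40 ≤ a₀·ℓ_T`) hold eventually in `k` along the top shell: `ℓ_T ≥ c(k−1)/2 − 4 ≥ 3.5k − 7.5`.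
[folklore] -/
theorem near_thresholds_eventually (hc7 : 7 ≤ c) (hc8 : c < 8) :
    ∃ k₁ : ℕ, ∀ k : ℕ, k₁ ≤ k → ∀ T : ℝ, c * ((k : ℝ) - 1) / 2 - 4 ≤ ell T →
      100 ≤ k ∧ 40 ≤ (2 / c - 1 / 4) * ell T := by
  have hc0 : 0 < c := by linarith only [hc7]
  have ha₀ : 0 < 2 / c - 1 / 4 := by
    have : 1 / 4 < 2 / c := by rw [div_lt_div_iff₀ (by norm_num) hc0]; linarith only [hc8]
    linarith only [this]
  set a₀ : ℝ := 2 / c - 1 / 4 with ha₀def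
  clear_value a₀
  refine ⟨max 100 (Nat.ceil ((40 / a₀ + 15 / 2) / (7 / 2))), fun k hk T hℓ => ?_⟩
  have hk100 : 100 ≤ k := le_trans (le_max_left _ _) hk
  have hkceil : (40 / a₀ + 15 / 2) / (7 / 2) ≤ (k : ℝ) :=
    (Nat.le_ceil _).trans (by exact_mod_cast le_trans (le_max_right _ _) hk)
  refine ⟨hk100, ?_⟩
  have hk' : 40 / a₀ + 15 / 2 ≤ 7 / 2 * (k : ℝ) := by
    rw [div_le_iff₀ (by norm_num)] at hkceil; linarith only [hkceil]
  have hk0 : (100 : ℝ) ≤ k := by exact_mod_cast hk100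
  have hck : 7 * ((k : ℝ) - 1) ≤ c * ((k : ℝ) - 1) :=
    mul_le_mul_of_nonneg_right hc7 (by linarith only [hk0])
  have hℓk : 7 / 2 * (k : ℝ) - 15 / 2 ≤ ell T := by linarith only [hck, hℓ]
  have h40 : 40 / a₀ ≤ ell T := by linarith only [hk', hℓk]
  rw [div_le_iff₀ ha₀] at h40
  linarith only [h40]

/-- **[CMP] at every near point, eventually in `k`** — `norm_arcMainTerm_sub_arcShiftModel_le_near'`
with its two scalar thresholds folded into `∃ k₁`: the hypotheses left are EXACTLY the binders of
`HDISC c` in `shellNear_of_discModels` (at `(k, x, T)`), the centre saddle `u₀`, a disc point `v` with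
`‖v − v₀‖ ≤ 3/ℓ_T` and its saddle `u*`. RH-FREE. [folklore] -/
theorem norm_arcMainTerm_sub_arcShiftModel_le_near_eventually (hc7 : 7 ≤ c) (hc8 : c < 8) :
    ∃ k₁ : ℕ, ∀ k : ℕ, k₁ ≤ k → ∀ x T : ℝ, |x| ≤ 2 / c - 1 / 4 → 200 ≤ T → 200 ≤ ell T →
      c * ((k : ℝ) - 1) / 2 - 4 ≤ ell T → ell T ≤ c * (k : ℝ) / 2 →
      4 / c < bandRadius k T → bandRadius k T ≤ 4 / c + 1 / Real.log k →
      bandRadius k T ≤ 7 / 20 * T →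
      ∀ u₀ : ℂ, ‖u₀ - ((x : ℂ) + (T : ℂ) * I + bandRadius k T)‖ ≤ 3 / 5 * bandRadius k T →
      arcSaddleFn k ((x : ℂ) + (T : ℂ) * I) u₀ = 0 →
      ∀ v ∈ closedBall ((x : ℂ) + (T : ℂ) * I) (3 / ell T), ∀ u : ℂ,
      ‖u - (((v.re : ℝ) : ℂ) + ((v.im : ℝ) : ℂ) * I + bandRadius k v.im)‖ ≤ 3 / 5 * bandRadius k v.im →
      arcSaddleFn k (((v.re : ℝ) : ℂ) + ((v.im : ℝ) : ℂ) * I) u = 0 →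
      ‖arcMainTerm k v u - arcShiftModel k ((x : ℂ) + (T : ℂ) * I) u₀ v‖ ≤
        1 / 100 * ‖arcShiftModel k ((x : ℂ) + (T : ℂ) * I) u₀ v‖ := by
  obtain ⟨k₁, hk₁⟩ := near_thresholds_eventually hc7 hc8
  refine ⟨k₁, fun k hk x T hx hT hℓ hℓlo hℓhi hh hh' hhT u₀ hu₀ hS₀ v hv u hu hS => ?_⟩
  obtain ⟨hk100, hℓa⟩ := hk₁ k hk T hℓlo
  rw [mem_closedBall, dist_eq_norm] at hv
  exact norm_arcMainTerm_sub_arcShiftModel_le_near' hc7 hc8 hk100 hx hT hℓ hℓlo hℓhi hh hh' hhT hℓa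
    hu₀ hS₀ hv hu hS

end near

end Summit.RiemannHypothesis.RiemannHypothesis.Theorems.JensenPolynomials.LogBandArc

end
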